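import Literature.MathematicalPhysics.QuantumFieldTheory.Balaban1983to89.Node00.CriticalOnFibreTopGuarded
import Literature.MathematicalPhysics.QuantumFieldTheory.Balaban1983to89.Node00.CriticalOnFibreB

/-!
# NODE 00 — THE GUARD-GENERIC STEP TOKENS OVER A **BOND-LEVEL DETERMINING DATUM** AND A **TOP-DATA PREDICATE**: `Prop8RegSepTopStepGB`, `HalvingStepTopGB`, `HalvingStepTopCoreGB` —
# F0c of the (E1)∕(iii-b) work plan (director-ym №338∕№339; FLAG №16; LOCATE-HSEAM 5d3298b8d191f169); module 47's tokens are the instance `(genSetDatum F, dataSmall7PTopOf F N)` by `Iff.rfl`,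
# print's [II] (2.3) datum is the instance `bd := lamDatum F`

Cell `pub-ymgap`, seat `pub-ymgap-dag-n07-e` g33 (lineage of module 47 `Node00/CriticalOnFibreTopGuarded`, n07-e g20).  `--kind definition --supports stmt-QuantumFields-20541` (K0⁷; count-neutral).
PURELY ADDITIVE — «print-datum parametrisation of `Node00/CriticalOnFibreTopGuarded` (FLAG №16 ∕ LOCATE-HSEAM 5d3298b8d191f169); the (b)-instances `Prop8RegSepTopStepG ∕ HalvingStepTopG ∕
HalvingStepTopCoreG` stay landed and true on their own text»; no displayed premise of any token is deleted or weakened — two rows become PARAMETERS, and the old rows are one instance.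
[15] = [Balaban1985Variational]; [6] = [Balaban1985RegularSpaces]; [II] = [Balaban1984PropagatorsII]; [III] = [Balaban1988Convergent]; [I] = [Balaban1987RG1].

WHY (LOCATE-HSEAM (γ), director-ym №339 (α)).  Module 47's three named facts carry the FIBRE ROWS `AgreeOn (genSet s.Ω k) (Ū U) W → IsCritOnFibre F N K (genSet s.Ω k) W U` — [III] (2.10)'s
determining-set fibre in READING (b) («bonds which intersect Γ_j», [I] p. 251) — and the DATA ROW `Sect2.DataSmall7PTop (avOfRecord F N K) s.Ω (Sup ν K s.Ω) k δ W` ([15] (7) read on the same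
bond class).  Print's Prop. 8 ∕ Sect. F are statements about the minimiser on the [II] (2.3) fibre «Λ_j = Ω_j^{(j)} ∖ Ω_{j+1}^{(j)} … for the sets of sites and the sets of bonds» (p. 224; the
DIFFERENCE of the bond sets — inward connectors belong to no `Λ_j`, ruling (α) of record), a LARGER curve class and a SMALLER constraint.  Exactly as module 47 made every GUARD an
instantiation (`Adm : StepGuard F`), this file makes every DATUM READING an instantiation: the fibre rows read `AgreeOnB (bd K k s.Ω) (Ū U) W → IsCritOnFibreB F N K (bd K k s.Ω) W U` for a
bond-datum family `bd : BondDatum F` (F0a `B15DeterminingSetsB`, F0b `Node00/CriticalOnFibreB`), the data row reads `Dat K s.Ω (Sup ν K s.Ω) k δ W` for a top-data predicate `Dat : TopData F N`.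
Module 47 is the instance `(genSetDatum F, dataSmall7PTopOf F N)` — `Iff.rfl`; print's road is the instance `bd := lamDatum F` (`lamBondsSeq`, F0a) with the (7) data predicate of the print
datum (F0d's, plugged in as `Dat` — this file does not wait for it).  Every composition of the chain is POINTWISE in `(W, U)` and merely THREADS the three rows, so the §1∕§2 API of module 47
re-proves with the same terms for every `(bd, Dat)`.

WHAT IS HERE (sorry-free; TEN definitions — three parameter types, four instances of record (`genSetDatum`, `lamDatum`, `dataSmall7PTopOf`, `printedPlaqs0Of`) and three named facts
(`Prop`s, never asserted) — plus bookkeeping).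
* §0 `BondDatum F`, `TopData F N`, `PlaqRange0 F`; `genSetDatum F` (reading (b)), `lamDatum F` (print's (2.3)), `dataSmall7PTopOf F N` (module 53's (7) clause as a `TopData`), `printedPlaqs0Of F`
  (module 47's literal level-0 exclusion); `lamDatum_subset_genSetDatum`; `…_apply` unfoldings.
* §1 `Prop8RegSepTopStepGB ∕ HalvingStepTopGB F N Sup Adm bd Dat B₃ a₀ a₁` and `HalvingStepTopCoreGB F N Sup Adm bd Dat Ex0 B₃ a₀ a₁` (bodies = module 47 :108–146 with the three rows — and,
  in the core form, the level-0 plaquette exclusion — parametrised, every other byte identical); ★ `prop8RegSepTopStepG_iff_GB ∕ halvingStepTopG_iff_GB ∕ halvingStepTopCoreG_iff_GB` (module 47's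
  tokens ARE the instance `(genSetDatum F) (dataSmall7PTopOf F N) [(printedPlaqs0Of F)]`, `Iff.rfl`); for each token `.of_le` (antitone in `a₀ a₁`), `.of_imp` (antitone in the guard), `.of_imp_dat`
  (antitone in the data predicate), for `Prop8RegSepTopStepGB` also `.and_right ∕ .and_left`, for the core form `.of_subset_ex0`; ★ `halvingStepTopCoreGB_of_halvingStepTopGB` (every `Ex0`).
* §2 ★ `classTop_iterate_of_halvingStepTopGB`, ★★ `prop8RegSepTopStepGB_of_halvingStepTopGB` (`0 < B₃`), ★ `halvingStepTopGB_of_prop8RegSepTopStepGB`, ★★ `halvingStepTopGB_iff_prop8RegSepTopStepGB`,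
  `prop8RegSepTopStepGB_of_coreGB_of_link` — module 47 §2 with `(bd, Dat)` threaded; the proofs are the same terms.
NOT HERE: the (7) data predicate of the print datum (F0d, def-R lineage — an instance of `TopData F N`), the 53-G road's twins (S1a), the (9)′ gauge lift (S1b), the K0 chart road's twins
(S1c), the stub texts (V23).  The core form's level-0 BOND exclusion `b ∉ Sect2.bondsDeep (s.Ω 1)ᶜ` stays as printed (node00-def-R COORD-1 (A2): each stencil plaquette of such a bond is
either all-pinned print data or a core plaquette under the smaller `Ex0`).
HONEST SCOPE.  Definitions of named facts + binder-threading bookkeeping; nothing of [15]'s analysis asserted or proved; no (b)-instance fact is claimed false (FLAG №16 concerns which instance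
print PROVES); K0⁷ stub 1 NOT closed; N07 NOT discharged; counts unmoved (typed 28∕28 · discharged 8∕28); one finite 𝕋⁴ programme at fixed ε — nothing continuum ∕ ℝ⁴ ∕ OS ∕ mass gap ∕ Clay.
No `sorry`, no `instance`, no `notation`.

References: [15] (7) p.278, (144) p.300, (161)–(163) p.303, Prop. 8 p.304, Sect. F pp.300–304; [6] (1.3)–(1.9) p.77; [II] (2.3) p.224; [III] (2.2) p.255, (2.10)–(2.12) p.256; [I] (0.1) p.251.
-/

noncomputable section

namespace Literature.MathematicalPhysics.QuantumFieldTheory.Balaban1983to89.Node00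

open scoped Matrix.Norms.L2Operator
open T4Continuum (T4Family)
open B15DeterminingSets B15DeterminingSetsB

/-- `η_n ≥ 0` on the lattices of record. [cite: Balaban1987RG1, (1.1) p.260 (bookkeeping)] -/
private theorem eta_nonneg_b (P : Params) (n : ℕ) : 0 ≤ P.eta n := by
  unfold Params.eta
  exact pow_nonneg (inv_nonneg.mpr (Nat.cast_nonneg _)) n

/-- Weakening the threshold of the record's `PlaqSmallOn`. [cite: Balaban1988Convergent, (1.4) p.247 (bookkeeping)] -/
private theorem plaqSmallOn_of_le_b {P : Params} {j : ℕ} {G : Type*} [GaugeGroup G] {S : Set (Plaq P j)} {δ δ' : ℝ} {U : GaugeField P j G}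
    (h : PlaqSmallOn S δ U) (hδ : δ ≤ δ') : PlaqSmallOn S δ' U :=
  fun p hp => (h p hp).trans_le hδ

/-- `max{B₃δ, c} ≤ 2·max{B₃δ′, c}` from `δ ≤ 2δ′` (`B₃, c ≥ 0`). [cite: Balaban1985Variational, p.304 before Prop. 8 (bookkeeping)] -/
private theorem max_le_two_mul_max_b {B₃ c d d' : ℝ} (hB₃ : 0 ≤ B₃) (hc : 0 ≤ c) (hd : d ≤ 2 * d') :
    max (B₃ * d) c ≤ 2 * max (B₃ * d') c := by
  refine max_le ?_ ?_
  · calc B₃ * d ≤ B₃ * (2 * d') := mul_le_mul_of_nonneg_left hd hB₃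
      _ = 2 * (B₃ * d') := by ring
      _ ≤ 2 * max (B₃ * d') c := mul_le_mul_of_nonneg_left (le_max_left _ _) zero_le_two
  · calc c ≤ 2 * c := le_mul_of_one_le_left hc one_le_two
      _ ≤ 2 * max (B₃ * d') c := mul_le_mul_of_nonneg_left (le_max_right _ _) zero_le_two

/-! ## §0  The two parameter types and their instances of record -/

section Params0

variable (F : T4Family) (N : ℕ)

/-- **A BOND-DATUM FAMILY**: for every torus exponent `K`, step `k` and (2.18) index `Ω`, the bond-level determining datum `𝔅 = {𝔅_j ⊆ bonds of T^{(j)}}` on which the step's minimiser is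
constrained ([III] (2.10) with the bond class a parameter: reading (b) `bondsDet (genSet Ω k)`, or print's [II] (2.3) `lamBondsSeq Ω k`).
[cite: Balaban1988Convergent, (2.10) p.256; Balaban1984PropagatorsII, (2.3) p.224; Balaban1987RG1, (0.1) p.251] -/
abbrev BondDatum : Type _ := (K k : ℕ) → (ℕ → Set (Site (F.P K) 0)) → BDetSet (F.P K)

/-- **A TOP-DATA PREDICATE**: [15] (7)'s smallness hypothesis on the data `W` for the top domain, as a parameter — arguments `K`, the index `Ω`, the top domain `Ω₀`, the step `k`, the
thresholds `δ`, the data `W` (module 53's `Sect2.DataSmall7PTop (avOfRecord F N K)` is the instance of record, `dataSmall7PTopOf`). [cite: Balaban1985Variational, (3),(7) p.278; Balaban1985RegularSpaces, (1.3)–(1.9) p.77] -/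
abbrev TopData : Type _ := (K : ℕ) → (ℕ → Set (Site (F.P K) 0)) → Set (Site (F.P K) 0) → ℕ → (ℕ → ℝ) → MSField (F.P K) (SU N) → Prop

/-- READING (b)'s datum family: the bonds MEETING the members of [III] (2.2)'s determining set `genSet Ω k` ([I] p. 251 «bonds which intersect Γ_j»). [cite: Balaban1988Convergent, (2.2) p.255, (2.10) p.256; Balaban1987RG1, (0.1) p.251] -/
def genSetDatum : BondDatum F := fun _ k Ω => bondsDet (genSet Ω k)

/-- PRINT's datum family: [II] (2.3) `Λ_j = Ω_j^{(j)} ∖ Ω_{j+1}^{(j)}` «for the sets of sites and the sets of bonds» — the DIFFERENCE of the bond sets (ruling (α) of record, director-ym №339: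
inward connectors belong to no `Λ_j`), spelled Domains-free by F0a's `lamBondsSeq Ω k`. [cite: Balaban1984PropagatorsII, (2.3) p.224; Balaban1988Convergent, (2.2) p.255] -/
def lamDatum : BondDatum F := fun _ k Ω => lamBondsSeq Ω k

variable [NeZero N]

/-- Module 53's (7) clause for the top domain, as a `TopData` (the data row of module 47's tokens). [cite: Balaban1985Variational, (3),(7) p.278; Balaban1988Convergent, (2.10)–(2.12) p.256] -/
def dataSmall7PTopOf : TopData F N := fun K Ω Ω₀ k δ W => Sect2.DataSmall7PTop (avOfRecord F N K) Ω Ω₀ k δ W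

variable {N} in
/-- **A LEVEL-0 PLAQUETTE RANGE**: for every `K`, step `k` and index `Ω`, the level-0 plaquettes EXCLUDED from the core form's conclusion (where the pinned data supply the smallness
directly): module 47's literal `Sect2.printedPlaqs s.Ω k 0` (reading (b)) or print's smaller (7)-range with the one-deep-corner plaquettes OUT (ruling (α); F0d ∕ §7′'s name) — the
binder node00-def-R asked for (COORD-1 (A2), 2026-08-30), so that the Summits-side core-to-top link re-runs verbatim at the print instance. [cite: Balaban1985Variational, (7) p.278, Sect. F p.304; Balaban1984PropagatorsII, (2.3) p.224] -/
abbrev PlaqRange0 : Type _ := (K k : ℕ) → (ℕ → Set (Site (F.P K) 0)) → Set (Plaq (F.P K) 0)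

variable {N} in
/-- Module 47's literal level-0 exclusion range `Sect2.printedPlaqs Ω k 0`, as a `PlaqRange0` (reading (b)'s instance). [cite: Balaban1985Variational, (7) p.278 (bookkeeping)] -/
def printedPlaqs0Of : PlaqRange0 F := fun _ k Ω => Sect2.printedPlaqs Ω k 0

variable {F}

/-- Print's datum is contained in reading (b)'s, levelwise — NO hypotheses (F0a `lamBondsSeq_subset_bondsDet`). [cite: Balaban1984PropagatorsII, (2.3) p.224; Balaban1987RG1, (0.1) p.251] -/
theorem lamDatum_subset_genSetDatum (K k : ℕ) (Ω : ℕ → Set (Site (F.P K) 0)) (j : ℕ) : lamDatum F K k Ω j ⊆ genSetDatum F K k Ω j :=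
  lamBondsSeq_subset_bondsDet Ω k j

/-- Unfolding of `genSetDatum`. [cite: Balaban1988Convergent, (2.2) p.255 (bookkeeping)] -/
theorem genSetDatum_apply (K k : ℕ) (Ω : ℕ → Set (Site (F.P K) 0)) : genSetDatum F K k Ω = bondsDet (genSet Ω k) := rfl

/-- Unfolding of `lamDatum`. [cite: Balaban1984PropagatorsII, (2.3) p.224 (bookkeeping)] -/
theorem lamDatum_apply (K k : ℕ) (Ω : ℕ → Set (Site (F.P K) 0)) : lamDatum F K k Ω = lamBondsSeq Ω k := rfl

variable {N}

/-- Unfolding of `printedPlaqs0Of`. [cite: Balaban1985Variational, (7) p.278 (bookkeeping)] -/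
theorem printedPlaqs0Of_apply (K k : ℕ) (Ω : ℕ → Set (Site (F.P K) 0)) : printedPlaqs0Of F K k Ω = Sect2.printedPlaqs Ω k 0 := rfl

/-- Unfolding of `dataSmall7PTopOf`. [cite: Balaban1985Variational, (7) p.278 (bookkeeping)] -/
theorem dataSmall7PTopOf_apply (K : ℕ) (Ω : ℕ → Set (Site (F.P K) 0)) (Ω₀ : Set (Site (F.P K) 0)) (k : ℕ) (δ : ℕ → ℝ) (W : MSField (F.P K) (SU N)) :
    dataSmall7PTopOf F N K Ω Ω₀ k δ W ↔ Sect2.DataSmall7PTop (avOfRecord F N K) Ω Ω₀ k δ W := Iff.rfl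

end Params0

/-! ## §1  The three tokens over `(bd, Dat)` and their API -/

section FactsGB

variable (F : T4Family) (N : ℕ) [NeZero N]

/-- **[15] PROPOSITION 8's TOP STEP, GUARD-GENERIC, OVER A BOND DATUM AND A TOP-DATA PREDICATE**: module 47's `Prop8RegSepTopStepG` with the data row `Dat K s.Ω (Sup ν K s.Ω) k δ W` and the
fibre rows `AgreeOnB (bd K k s.Ω) (Ū U) W → IsCritOnFibreB F N K (bd K k s.Ω) W U`; every other byte identical.  Print-datum parametrisation of `Prop8RegSepTopStepG` (FLAG №16 ∕ LOCATE-HSEAM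
5d3298b8d191f169); the (b)-instance `Prop8RegSepTopStepG` stays landed and true on its own text (`prop8RegSepTopStepG_iff_GB`).
[cite: Balaban1985Variational, Prop. 8 p.304, (7) p.278; Balaban1985RegularSpaces, (1.3)–(1.6) p.77; Balaban1984PropagatorsII, (2.3) p.224; Balaban1987RG1, (0.1) p.251] -/
def Prop8RegSepTopStepGB (Sup : (ν : Stage7Numerics) → (K : ℕ) → (ℕ → Set (Site (F.P K) 0)) → Set (Site (F.P K) 0)) (Adm : StepGuard F) (bd : BondDatum F) (Dat : TopData F N)
    (B₃ a₀ a₁ : ℝ) : Prop :=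
  ∀ (ν : Stage7Numerics) (M : ℕ) (g : ℕ → ℝ) (K k : ℕ) (s : SeqOfRecord F ν M g K k), Sect2.SeqSeparated ν.M₁ s → 0 < ν.M₁ → Adm ν M g K k s → 1 ≤ k →
    ∀ (ε₀ : ℝ) (δ : ℕ → ℝ),
    (∀ n, n ≤ k → 0 < δ n ∧ δ n ≤ a₁ ∧ B₃ * δ n ≤ ε₀) → (∀ n, n < k → δ n ≤ 2 * δ (n + 1)) → (∀ n, n < k → δ (n + 1) ≤ 2 * δ n) → ε₀ ≤ a₀ →
    ∀ W : MSField (F.P K) (SU N), Dat K s.Ω (Sup ν K s.Ω) k δ W →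
      ∀ U : GaugeField (F.P K) 0 (SU N),
        (∀ n, n ≤ k → PlaqSmallOn (Sect2.omegaPlaqsTop s.Ω (Sup ν K s.Ω) n) (ε₀ * (F.P K).eta n ^ 2) U) →
        Sect2.CoDivClassOnTop s.Ω (Sup ν K s.Ω) k ε₀ U → AgreeOnB (bd K k s.Ω) (avgFamily (avOfRecord F N K) U) W →
        IsCritOnFibreB F N K (bd K k s.Ω) W U →
        (∀ n, n ≤ k → PlaqSmallOn (Sect2.omegaPlaqsTop s.Ω (Sup ν K s.Ω) n) (B₃ * δ n * (F.P K).eta n ^ 2) U) ∧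
          ∀ n, n ≤ k → Sect2.CoDivSmallOn (Sect2.omegaBondsTop s.Ω (Sup ν K s.Ω) n) (B₃ * δ n * (F.P K).eta n ^ 3) U

/-- **SECT. F's ONE-STEP IMPROVEMENT, GUARD-GENERIC, OVER `(bd, Dat)`**: module 47's `HalvingStepTopG` with the three rows parametrised.  Print-datum parametrisation of `HalvingStepTopG`
(FLAG №16 ∕ LOCATE-HSEAM 5d3298b8d191f169); the (b)-instance stays landed and true on its own text (`halvingStepTopG_iff_GB`).
[cite: Balaban1985Variational, Sect. F p.304, (7) p.278; Balaban1984PropagatorsII, (2.3) p.224; Balaban1987RG1, (0.1) p.251] -/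
def HalvingStepTopGB (Sup : (ν : Stage7Numerics) → (K : ℕ) → (ℕ → Set (Site (F.P K) 0)) → Set (Site (F.P K) 0)) (Adm : StepGuard F) (bd : BondDatum F) (Dat : TopData F N)
    (B₃ a₀ a₁ : ℝ) : Prop :=
  ∀ (ν : Stage7Numerics) (M : ℕ) (g : ℕ → ℝ) (K k : ℕ) (s : SeqOfRecord F ν M g K k), Sect2.SeqSeparated ν.M₁ s → 0 < ν.M₁ → Adm ν M g K k s → 1 ≤ k →
    ∀ (ε δ : ℕ → ℝ),
    (∀ n, n ≤ k → 0 < δ n ∧ δ n ≤ a₁) → (∀ n, n < k → δ n ≤ 2 * δ (n + 1)) → (∀ n, n < k → δ (n + 1) ≤ 2 * δ n) →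
    (∀ n, n ≤ k → B₃ * δ n ≤ ε n ∧ ε n ≤ a₀) → (∀ n, n < k → ε n ≤ 2 * ε (n + 1)) → (∀ n, n < k → ε (n + 1) ≤ 2 * ε n) →
    ∀ W : MSField (F.P K) (SU N), Dat K s.Ω (Sup ν K s.Ω) k δ W →
      ∀ U : GaugeField (F.P K) 0 (SU N),
        (∀ n, n ≤ k → PlaqSmallOn (Sect2.omegaPlaqsTop s.Ω (Sup ν K s.Ω) n) (ε n * (F.P K).eta n ^ 2) U) →
        (∀ n, n ≤ k → Sect2.CoDivSmallOn (Sect2.omegaBondsTop s.Ω (Sup ν K s.Ω) n) (ε n * (F.P K).eta n ^ 3) U) →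
        AgreeOnB (bd K k s.Ω) (avgFamily (avOfRecord F N K) U) W →
        IsCritOnFibreB F N K (bd K k s.Ω) W U →
        (∀ n, n ≤ k → PlaqSmallOn (Sect2.omegaPlaqsTop s.Ω (Sup ν K s.Ω) n) (max (B₃ * δ n) (ε n / 2) * (F.P K).eta n ^ 2) U) ∧
          ∀ n, n ≤ k → Sect2.CoDivSmallOn (Sect2.omegaBondsTop s.Ω (Sup ν K s.Ω) n) (max (B₃ * δ n) (ε n / 2) * (F.P K).eta n ^ 3) U

/-- **THE CORE FORM, GUARD-GENERIC, OVER `(bd, Dat)`**: module 47's `HalvingStepTopCoreG` with the three rows parametrised AND the level-0 plaquette exclusion a parameter `Ex0 : PlaqRange0 F`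
(read `p ∉ Ex0 K k s.Ω`; module 47's literal is the instance `printedPlaqs0Of F`; the bond exclusion `b ∉ Sect2.bondsDeep (s.Ω 1)ᶜ` stays as printed).  Print-datum
parametrisation of `HalvingStepTopCoreG` (FLAG №16 ∕ LOCATE-HSEAM 5d3298b8d191f169); the (b)-instance stays landed and true on its own text (`halvingStepTopCoreG_iff_GB`).
[cite: Balaban1985Variational, Sect. F p.304, (7) p.278; Balaban1984PropagatorsII, (2.3) p.224; Balaban1987RG1, (0.1) p.251] -/
def HalvingStepTopCoreGB (Sup : (ν : Stage7Numerics) → (K : ℕ) → (ℕ → Set (Site (F.P K) 0)) → Set (Site (F.P K) 0)) (Adm : StepGuard F) (bd : BondDatum F) (Dat : TopData F N)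
    (Ex0 : PlaqRange0 F) (B₃ a₀ a₁ : ℝ) : Prop :=
  ∀ (ν : Stage7Numerics) (M : ℕ) (g : ℕ → ℝ) (K k : ℕ) (s : SeqOfRecord F ν M g K k), Sect2.SeqSeparated ν.M₁ s → 0 < ν.M₁ → Adm ν M g K k s → 1 ≤ k →
    ∀ (ε δ : ℕ → ℝ),
    (∀ n, n ≤ k → 0 < δ n ∧ δ n ≤ a₁) → (∀ n, n < k → δ n ≤ 2 * δ (n + 1)) → (∀ n, n < k → δ (n + 1) ≤ 2 * δ n) →
    (∀ n, n ≤ k → B₃ * δ n ≤ ε n ∧ ε n ≤ a₀) → (∀ n, n < k → ε n ≤ 2 * ε (n + 1)) → (∀ n, n < k → ε (n + 1) ≤ 2 * ε n) →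
    ∀ W : MSField (F.P K) (SU N), Dat K s.Ω (Sup ν K s.Ω) k δ W →
      ∀ U : GaugeField (F.P K) 0 (SU N),
        (∀ n, n ≤ k → PlaqSmallOn (Sect2.omegaPlaqsTop s.Ω (Sup ν K s.Ω) n) (ε n * (F.P K).eta n ^ 2) U) →
        (∀ n, n ≤ k → Sect2.CoDivSmallOn (Sect2.omegaBondsTop s.Ω (Sup ν K s.Ω) n) (ε n * (F.P K).eta n ^ 3) U) →
        AgreeOnB (bd K k s.Ω) (avgFamily (avOfRecord F N K) U) W →
        IsCritOnFibreB F N K (bd K k s.Ω) W U →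
        (∀ n, n ≤ k → ∀ p ∈ Sect2.omegaPlaqsTop s.Ω (Sup ν K s.Ω) n, p ∉ Ex0 K k s.Ω →
            dist1 (GaugeField.plaqHol U p) < max (B₃ * δ n) (ε n / 2) * (F.P K).eta n ^ 2) ∧
          ∀ n, n ≤ k → ∀ b ∈ Sect2.omegaBondsTop s.Ω (Sup ν K s.Ω) n, b ∉ Sect2.bondsDeep (s.Ω 1)ᶜ →
            ‖Sect2.coDivSum U b.src b.dir‖ < max (B₃ * δ n) (ε n / 2) * (F.P K).eta n ^ 3

variable {F N}

/-! ### The instances of record: module 47's tokens, by `Iff.rfl` -/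

/-- ★ Module 47's `Prop8RegSepTopStepG` IS the instance `(genSetDatum F) (dataSmall7PTopOf F N)` — definitionally (`AgreeOn 𝔹 = AgreeOnB (bondsDet 𝔹)` and `IsCritOnFibre … 𝔹 = IsCritOnFibreB … (bondsDet 𝔹)`
are `rfl`). [cite: Balaban1985Variational, Prop. 8 p.304; Balaban1988Convergent, (2.10) p.256; Balaban1987RG1, (0.1) p.251] -/
theorem prop8RegSepTopStepG_iff_GB {Sup : (ν : Stage7Numerics) → (K : ℕ) → (ℕ → Set (Site (F.P K) 0)) → Set (Site (F.P K) 0)} {Adm : StepGuard F} {B₃ a₀ a₁ : ℝ} :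
    Prop8RegSepTopStepG F N Sup Adm B₃ a₀ a₁ ↔ Prop8RegSepTopStepGB F N Sup Adm (genSetDatum F) (dataSmall7PTopOf F N) B₃ a₀ a₁ := Iff.rfl

/-- ★ Module 47's `HalvingStepTopG` IS the instance `(genSetDatum F) (dataSmall7PTopOf F N)`, definitionally. [cite: Balaban1985Variational, Sect. F p.304; Balaban1988Convergent, (2.10) p.256] -/
theorem halvingStepTopG_iff_GB {Sup : (ν : Stage7Numerics) → (K : ℕ) → (ℕ → Set (Site (F.P K) 0)) → Set (Site (F.P K) 0)} {Adm : StepGuard F} {B₃ a₀ a₁ : ℝ} :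
    HalvingStepTopG F N Sup Adm B₃ a₀ a₁ ↔ HalvingStepTopGB F N Sup Adm (genSetDatum F) (dataSmall7PTopOf F N) B₃ a₀ a₁ := Iff.rfl

/-- ★ Module 47's `HalvingStepTopCoreG` IS the instance `(genSetDatum F) (dataSmall7PTopOf F N) (printedPlaqs0Of F)`, definitionally. [cite: Balaban1985Variational, Sect. F p.304; Balaban1988Convergent, (2.10) p.256] -/
theorem halvingStepTopCoreG_iff_GB {Sup : (ν : Stage7Numerics) → (K : ℕ) → (ℕ → Set (Site (F.P K) 0)) → Set (Site (F.P K) 0)} {Adm : StepGuard F} {B₃ a₀ a₁ : ℝ} :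
    HalvingStepTopCoreG F N Sup Adm B₃ a₀ a₁ ↔ HalvingStepTopCoreGB F N Sup Adm (genSetDatum F) (dataSmall7PTopOf F N) (printedPlaqs0Of F) B₃ a₀ a₁ := Iff.rfl

/-! ### `Prop8RegSepTopStepGB`: API -/

/-- Antitone in the ceilings. [cite: Balaban1985Variational, Prop. 8 p.304 (bookkeeping)] -/
theorem Prop8RegSepTopStepGB.of_le {Sup : (ν : Stage7Numerics) → (K : ℕ) → (ℕ → Set (Site (F.P K) 0)) → Set (Site (F.P K) 0)} {Adm : StepGuard F} {bd : BondDatum F} {Dat : TopData F N}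
    {B₃ a₀ a₀' a₁ a₁' : ℝ} (h : Prop8RegSepTopStepGB F N Sup Adm bd Dat B₃ a₀ a₁) (ha₀ : a₀' ≤ a₀) (ha₁ : a₁' ≤ a₁) : Prop8RegSepTopStepGB F N Sup Adm bd Dat B₃ a₀' a₁' :=
  fun ν M g K k s hsep hM₁ hadm hk ε₀ δ hδ hcomp hcomp' hε₀ W h7 U h17 h19 hfib hcrit =>
    h ν M g K k s hsep hM₁ hadm hk ε₀ δ (fun n hn => ⟨(hδ n hn).1, (hδ n hn).2.1.trans ha₁, (hδ n hn).2.2⟩) hcomp hcomp' (hε₀.trans ha₀) W h7 U h17 h19 hfib hcrit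

/-- ANTITONE IN THE GUARD: a stronger guard `Adm′ ⇒ Adm` asks the sentence of fewer prefixes. [cite: Balaban1985Variational, Prop. 8 p.304 (bookkeeping)] -/
theorem Prop8RegSepTopStepGB.of_imp {Sup : (ν : Stage7Numerics) → (K : ℕ) → (ℕ → Set (Site (F.P K) 0)) → Set (Site (F.P K) 0)} {Adm Adm' : StepGuard F} {bd : BondDatum F} {Dat : TopData F N}
    {B₃ a₀ a₁ : ℝ} (h : Prop8RegSepTopStepGB F N Sup Adm bd Dat B₃ a₀ a₁) (himp : ∀ ν M g K k s, Adm' ν M g K k s → Adm ν M g K k s) :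
    Prop8RegSepTopStepGB F N Sup Adm' bd Dat B₃ a₀ a₁ :=
  fun ν M g K k s hsep hM₁ hadm' hk => h ν M g K k s hsep hM₁ (himp ν M g K k s hadm') hk


/-- ANTITONE IN THE DATA PREDICATE: a WEAKER data hypothesis `Dat′ ⇒ Dat` pointwise gives a STRONGER token (node00-def-T g25's `of_imp_dat`). [cite: Balaban1985Variational, (7) p.278, Prop. 8 p.304 (bookkeeping)] -/
theorem Prop8RegSepTopStepGB.of_imp_dat {Sup : (ν : Stage7Numerics) → (K : ℕ) → (ℕ → Set (Site (F.P K) 0)) → Set (Site (F.P K) 0)} {Adm : StepGuard F} {bd : BondDatum F} {Dat Dat' : TopData F N}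
    {B₃ a₀ a₁ : ℝ} (h : Prop8RegSepTopStepGB F N Sup Adm bd Dat B₃ a₀ a₁)
    (himp : ∀ (K : ℕ) (Ω : ℕ → Set (Site (F.P K) 0)) (Ω₀ : Set (Site (F.P K) 0)) (k : ℕ) (δ : ℕ → ℝ) (W : MSField (F.P K) (SU N)), Dat' K Ω Ω₀ k δ W → Dat K Ω Ω₀ k δ W) :
    Prop8RegSepTopStepGB F N Sup Adm bd Dat' B₃ a₀ a₁ :=
  fun ν M g K k s hsep hM₁ hadm hk ε₀ δ hδ hcomp hcomp' hε₀ W h7 => h ν M g K k s hsep hM₁ hadm hk ε₀ δ hδ hcomp hcomp' hε₀ W (himp _ _ _ _ _ _ h7)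

/-- Guards compose by conjunction: a fact guarded by `Adm₁` serves the guard `Adm₁ ∧ Adm₂`. [cite: Balaban1985Variational, Prop. 8 p.304 (bookkeeping)] -/
theorem Prop8RegSepTopStepGB.and_right {Sup : (ν : Stage7Numerics) → (K : ℕ) → (ℕ → Set (Site (F.P K) 0)) → Set (Site (F.P K) 0)} {Adm₁ Adm₂ : StepGuard F} {bd : BondDatum F} {Dat : TopData F N}
    {B₃ a₀ a₁ : ℝ} (h : Prop8RegSepTopStepGB F N Sup Adm₁ bd Dat B₃ a₀ a₁) :
    Prop8RegSepTopStepGB F N Sup (fun ν M g K k s => Adm₁ ν M g K k s ∧ Adm₂ ν M g K k s) bd Dat B₃ a₀ a₁ :=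
  h.of_imp fun _ _ _ _ _ _ h' => h'.1

/-- Guards compose by conjunction (left factor added). [cite: Balaban1985Variational, Prop. 8 p.304 (bookkeeping)] -/
theorem Prop8RegSepTopStepGB.and_left {Sup : (ν : Stage7Numerics) → (K : ℕ) → (ℕ → Set (Site (F.P K) 0)) → Set (Site (F.P K) 0)} {Adm₁ Adm₂ : StepGuard F} {bd : BondDatum F} {Dat : TopData F N}
    {B₃ a₀ a₁ : ℝ} (h : Prop8RegSepTopStepGB F N Sup Adm₂ bd Dat B₃ a₀ a₁) :
    Prop8RegSepTopStepGB F N Sup (fun ν M g K k s => Adm₁ ν M g K k s ∧ Adm₂ ν M g K k s) bd Dat B₃ a₀ a₁ :=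
  h.of_imp fun _ _ _ _ _ _ h' => h'.2

/-! ### `HalvingStepTopGB`: API -/

/-- Antitone in the ceilings (one step). [cite: Balaban1985Variational, Sect. F p.304 (bookkeeping)] -/
theorem HalvingStepTopGB.of_le {Sup : (ν : Stage7Numerics) → (K : ℕ) → (ℕ → Set (Site (F.P K) 0)) → Set (Site (F.P K) 0)} {Adm : StepGuard F} {bd : BondDatum F} {Dat : TopData F N}
    {B₃ a₀ a₀' a₁ a₁' : ℝ} (h : HalvingStepTopGB F N Sup Adm bd Dat B₃ a₀ a₁) (ha₀ : a₀' ≤ a₀) (ha₁ : a₁' ≤ a₁) : HalvingStepTopGB F N Sup Adm bd Dat B₃ a₀' a₁' :=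
  fun ν M g K k s hsep hM₁ hadm hk ε δ hδ hcomp hcomp' hε hεcomp hεcomp' W h7 U h17 h19 hfib hcrit =>
    h ν M g K k s hsep hM₁ hadm hk ε δ (fun n hn => ⟨(hδ n hn).1, (hδ n hn).2.trans ha₁⟩) hcomp hcomp'
      (fun n hn => ⟨(hε n hn).1, (hε n hn).2.trans ha₀⟩) hεcomp hεcomp' W h7 U h17 h19 hfib hcrit

/-- Antitone in the guard (one step). [cite: Balaban1985Variational, Sect. F p.304 (bookkeeping)] -/
theorem HalvingStepTopGB.of_imp {Sup : (ν : Stage7Numerics) → (K : ℕ) → (ℕ → Set (Site (F.P K) 0)) → Set (Site (F.P K) 0)} {Adm Adm' : StepGuard F} {bd : BondDatum F} {Dat : TopData F N}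
    {B₃ a₀ a₁ : ℝ} (h : HalvingStepTopGB F N Sup Adm bd Dat B₃ a₀ a₁) (himp : ∀ ν M g K k s, Adm' ν M g K k s → Adm ν M g K k s) :
    HalvingStepTopGB F N Sup Adm' bd Dat B₃ a₀ a₁ :=
  fun ν M g K k s hsep hM₁ hadm' hk => h ν M g K k s hsep hM₁ (himp ν M g K k s hadm') hk

/-- Antitone in the data predicate (one step). [cite: Balaban1985Variational, (7) p.278, Sect. F p.304 (bookkeeping)] -/
theorem HalvingStepTopGB.of_imp_dat {Sup : (ν : Stage7Numerics) → (K : ℕ) → (ℕ → Set (Site (F.P K) 0)) → Set (Site (F.P K) 0)} {Adm : StepGuard F} {bd : BondDatum F} {Dat Dat' : TopData F N}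
    {B₃ a₀ a₁ : ℝ} (h : HalvingStepTopGB F N Sup Adm bd Dat B₃ a₀ a₁)
    (himp : ∀ (K : ℕ) (Ω : ℕ → Set (Site (F.P K) 0)) (Ω₀ : Set (Site (F.P K) 0)) (k : ℕ) (δ : ℕ → ℝ) (W : MSField (F.P K) (SU N)), Dat' K Ω Ω₀ k δ W → Dat K Ω Ω₀ k δ W) :
    HalvingStepTopGB F N Sup Adm bd Dat' B₃ a₀ a₁ :=
  fun ν M g K k s hsep hM₁ hadm hk ε δ hδ hcomp hcomp' hε hεcomp hεcomp' W h7 =>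
    h ν M g K k s hsep hM₁ hadm hk ε δ hδ hcomp hcomp' hε hεcomp hεcomp' W (himp _ _ _ _ _ _ h7)

/-! ### `HalvingStepTopCoreGB`: API -/

/-- Antitone in the ceilings (core form). [cite: Balaban1985Variational, Sect. F p.304 (bookkeeping)] -/
theorem HalvingStepTopCoreGB.of_le {Sup : (ν : Stage7Numerics) → (K : ℕ) → (ℕ → Set (Site (F.P K) 0)) → Set (Site (F.P K) 0)} {Adm : StepGuard F} {bd : BondDatum F} {Dat : TopData F N}
    {Ex0 : PlaqRange0 F} {B₃ a₀ a₀' a₁ a₁' : ℝ} (h : HalvingStepTopCoreGB F N Sup Adm bd Dat Ex0 B₃ a₀ a₁) (ha₀ : a₀' ≤ a₀) (ha₁ : a₁' ≤ a₁) :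
    HalvingStepTopCoreGB F N Sup Adm bd Dat Ex0 B₃ a₀' a₁' :=
  fun ν M g K k s hsep hM₁ hadm hk ε δ hδ hcomp hcomp' hε hεcomp hεcomp' W h7 U h17 h19 hfib hcrit =>
    h ν M g K k s hsep hM₁ hadm hk ε δ (fun n hn => ⟨(hδ n hn).1, (hδ n hn).2.trans ha₁⟩) hcomp hcomp'
      (fun n hn => ⟨(hε n hn).1, (hε n hn).2.trans ha₀⟩) hεcomp hεcomp' W h7 U h17 h19 hfib hcrit

/-- Antitone in the guard (core form). [cite: Balaban1985Variational, Sect. F p.304 (bookkeeping)] -/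
theorem HalvingStepTopCoreGB.of_imp {Sup : (ν : Stage7Numerics) → (K : ℕ) → (ℕ → Set (Site (F.P K) 0)) → Set (Site (F.P K) 0)} {Adm Adm' : StepGuard F} {bd : BondDatum F} {Dat : TopData F N}
    {Ex0 : PlaqRange0 F} {B₃ a₀ a₁ : ℝ} (h : HalvingStepTopCoreGB F N Sup Adm bd Dat Ex0 B₃ a₀ a₁) (himp : ∀ ν M g K k s, Adm' ν M g K k s → Adm ν M g K k s) :
    HalvingStepTopCoreGB F N Sup Adm' bd Dat Ex0 B₃ a₀ a₁ :=
  fun ν M g K k s hsep hM₁ hadm' hk => h ν M g K k s hsep hM₁ (himp ν M g K k s hadm') hk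

/-- Antitone in the data predicate (core form). [cite: Balaban1985Variational, (7) p.278, Sect. F p.304 (bookkeeping)] -/
theorem HalvingStepTopCoreGB.of_imp_dat {Sup : (ν : Stage7Numerics) → (K : ℕ) → (ℕ → Set (Site (F.P K) 0)) → Set (Site (F.P K) 0)} {Adm : StepGuard F} {bd : BondDatum F} {Dat Dat' : TopData F N}
    {Ex0 : PlaqRange0 F} {B₃ a₀ a₁ : ℝ} (h : HalvingStepTopCoreGB F N Sup Adm bd Dat Ex0 B₃ a₀ a₁)
    (himp : ∀ (K : ℕ) (Ω : ℕ → Set (Site (F.P K) 0)) (Ω₀ : Set (Site (F.P K) 0)) (k : ℕ) (δ : ℕ → ℝ) (W : MSField (F.P K) (SU N)), Dat' K Ω Ω₀ k δ W → Dat K Ω Ω₀ k δ W) :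
    HalvingStepTopCoreGB F N Sup Adm bd Dat' Ex0 B₃ a₀ a₁ :=
  fun ν M g K k s hsep hM₁ hadm hk ε δ hδ hcomp hcomp' hε hεcomp hεcomp' W h7 =>
    h ν M g K k s hsep hM₁ hadm hk ε δ hδ hcomp hcomp' hε hεcomp hεcomp' W (himp _ _ _ _ _ _ h7)

/-- MONOTONE IN THE EXCLUSION RANGE: a SMALLER level-0 exclusion `Ex0′ ⊆ Ex0` is a STRONGER core token. [cite: Balaban1985Variational, (7) p.278, Sect. F p.304 (bookkeeping)] -/
theorem HalvingStepTopCoreGB.of_subset_ex0 {Sup : (ν : Stage7Numerics) → (K : ℕ) → (ℕ → Set (Site (F.P K) 0)) → Set (Site (F.P K) 0)} {Adm : StepGuard F} {bd : BondDatum F} {Dat : TopData F N}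
    {Ex0 Ex0' : PlaqRange0 F} {B₃ a₀ a₁ : ℝ} (h : HalvingStepTopCoreGB F N Sup Adm bd Dat Ex0' B₃ a₀ a₁)
    (hsub : ∀ (K k : ℕ) (Ω : ℕ → Set (Site (F.P K) 0)), Ex0' K k Ω ⊆ Ex0 K k Ω) : HalvingStepTopCoreGB F N Sup Adm bd Dat Ex0 B₃ a₀ a₁ := by
  intro ν M g K k s hsep hM₁ hadm hk ε δ hδ hcomp hcomp' hε hεcomp hεcomp' W h7 U h17 h19 hfib hcrit
  obtain ⟨hP, hD⟩ := h ν M g K k s hsep hM₁ hadm hk ε δ hδ hcomp hcomp' hε hεcomp hεcomp' W h7 U h17 h19 hfib hcrit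
  exact ⟨fun n hn p hp hpx => hP n hn p hp fun h' => hpx (hsub K k s.Ω h'), hD⟩

/-- ★ RESTRICTION with the guard and the datum: the full one-step fact implies its core form, for EVERY exclusion range `Ex0`. [cite: Balaban1985Variational, Sect. F p.304 (bookkeeping)] -/
theorem halvingStepTopCoreGB_of_halvingStepTopGB {Sup : (ν : Stage7Numerics) → (K : ℕ) → (ℕ → Set (Site (F.P K) 0)) → Set (Site (F.P K) 0)} {Adm : StepGuard F} {bd : BondDatum F}
    {Dat : TopData F N} (Ex0 : PlaqRange0 F) {B₃ a₀ a₁ : ℝ} (h : HalvingStepTopGB F N Sup Adm bd Dat B₃ a₀ a₁) : HalvingStepTopCoreGB F N Sup Adm bd Dat Ex0 B₃ a₀ a₁ := by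
  intro ν M g K k s hsep hM₁ hadm hk ε δ hδ hcomp hcomp' hε hεcomp hεcomp' W h7 U h17 h19 hfib hcrit
  obtain ⟨hP, hD⟩ := h ν M g K k s hsep hM₁ hadm hk ε δ hδ hcomp hcomp' hε hεcomp hεcomp' W h7 U h17 h19 hfib hcrit
  exact ⟨fun n hn p hp _ => hP n hn p hp, fun n hn b hb _ => hD n hn b hb⟩

end FactsGB

/-! ## §2  Module 47 §2 (iteration and equivalence) over `(bd, Dat)` -/

section IterationGB

variable {F : T4Family} {N : ℕ} [NeZero N]

/-- ★ «We continue this way», over `(bd, Dat)`: module 47's `classTop_iterate_of_halvingStepTopG` with the three rows parametrised. [cite: Balaban1985Variational, p.304 before Prop. 8] -/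
theorem classTop_iterate_of_halvingStepTopGB {Sup : (ν : Stage7Numerics) → (K : ℕ) → (ℕ → Set (Site (F.P K) 0)) → Set (Site (F.P K) 0)} {bd : BondDatum F} {Dat : TopData F N}
    {B₃ a₀ a₁ : ℝ} (hB₃ : 0 ≤ B₃) {Adm : StepGuard F} (h : HalvingStepTopGB F N Sup Adm bd Dat B₃ a₀ a₁) (ν : Stage7Numerics) (M : ℕ) (g : ℕ → ℝ) (K k : ℕ)
    (s : SeqOfRecord F ν M g K k) (hsep : Sect2.SeqSeparated ν.M₁ s) (hM₁ : 0 < ν.M₁) (hadm : Adm ν M g K k s) (hk : 1 ≤ k) (ε₀ : ℝ) (δ : ℕ → ℝ)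
    (hδ : ∀ n, n ≤ k → 0 < δ n ∧ δ n ≤ a₁ ∧ B₃ * δ n ≤ ε₀) (hcomp : ∀ n, n < k → δ n ≤ 2 * δ (n + 1))
    (hcomp' : ∀ n, n < k → δ (n + 1) ≤ 2 * δ n) (hε₀ : ε₀ ≤ a₀) (W : MSField (F.P K) (SU N))
    (h7 : Dat K s.Ω (Sup ν K s.Ω) k δ W) (U : GaugeField (F.P K) 0 (SU N))
    (h17 : ∀ n, n ≤ k → PlaqSmallOn (Sect2.omegaPlaqsTop s.Ω (Sup ν K s.Ω) n) (ε₀ * (F.P K).eta n ^ 2) U)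
    (h19 : Sect2.CoDivClassOnTop s.Ω (Sup ν K s.Ω) k ε₀ U) (hfib : AgreeOnB (bd K k s.Ω) (avgFamily (avOfRecord F N K) U) W)
    (hcrit : IsCritOnFibreB F N K (bd K k s.Ω) W U) (m : ℕ) :
    (∀ n, n ≤ k → PlaqSmallOn (Sect2.omegaPlaqsTop s.Ω (Sup ν K s.Ω) n) (max (B₃ * δ n) (ε₀ / 2 ^ m) * (F.P K).eta n ^ 2) U) ∧
      ∀ n, n ≤ k → Sect2.CoDivSmallOn (Sect2.omegaBondsTop s.Ω (Sup ν K s.Ω) n) (max (B₃ * δ n) (ε₀ / 2 ^ m) * (F.P K).eta n ^ 3) U := by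
  have hη : ∀ n, 0 ≤ (F.P K).eta n := eta_nonneg_b (F.P K)
  have hε₀nn : 0 ≤ ε₀ := (mul_nonneg hB₃ (hδ 0 (Nat.zero_le _)).1.le).trans (hδ 0 (Nat.zero_le _)).2.2
  induction m with
  | zero =>
    have hle : ∀ n, ε₀ ≤ max (B₃ * δ n) (ε₀ / 2 ^ 0) := fun n => by
      rw [pow_zero, div_one]
      exact le_max_right _ _
    exact ⟨fun n hn => plaqSmallOn_of_le_b (h17 n hn) (mul_le_mul_of_nonneg_right (hle n) (pow_nonneg (hη n) 2)),
      fun n hn => (h19 n hn).of_le (mul_le_mul_of_nonneg_right (hle n) (pow_nonneg (hη n) 3))⟩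
  | succ m ih =>
    have hc : 0 ≤ ε₀ / 2 ^ m := div_nonneg hε₀nn (pow_nonneg zero_le_two m)
    have hεblk : ∀ n, n ≤ k → B₃ * δ n ≤ max (B₃ * δ n) (ε₀ / 2 ^ m) ∧ max (B₃ * δ n) (ε₀ / 2 ^ m) ≤ a₀ := fun n hn =>
      ⟨le_max_left _ _, (B11Prop8Assembly.stage_le (hδ n hn).2.2 hε₀nn m).trans hε₀⟩
    have hεcomp : ∀ n, n < k → max (B₃ * δ n) (ε₀ / 2 ^ m) ≤ 2 * max (B₃ * δ (n + 1)) (ε₀ / 2 ^ m) := fun n hn =>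
      max_le_two_mul_max_b hB₃ hc (hcomp n hn)
    have hεcomp' : ∀ n, n < k → max (B₃ * δ (n + 1)) (ε₀ / 2 ^ m) ≤ 2 * max (B₃ * δ n) (ε₀ / 2 ^ m) := fun n hn =>
      max_le_two_mul_max_b hB₃ hc (hcomp' n hn)
    obtain ⟨hP, hD⟩ := h ν M g K k s hsep hM₁ hadm hk (fun n => max (B₃ * δ n) (ε₀ / 2 ^ m)) δ (fun n hn => ⟨(hδ n hn).1, (hδ n hn).2.1⟩) hcomp
      hcomp' hεblk hεcomp hεcomp' W h7 U ih.1 ih.2 hfib hcrit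
    have hhalf : ∀ n, n ≤ k → max (B₃ * δ n) (max (B₃ * δ n) (ε₀ / 2 ^ m) / 2) ≤ max (B₃ * δ n) (ε₀ / 2 ^ (m + 1)) := fun n hn =>
      B11Prop8Assembly.max_half_le (mul_nonneg hB₃ (hδ n hn).1.le) m
    exact ⟨fun n hn => plaqSmallOn_of_le_b (hP n hn) (mul_le_mul_of_nonneg_right (hhalf n hn) (pow_nonneg (hη n) 2)),
      fun n hn => (hD n hn).of_le (mul_le_mul_of_nonneg_right (hhalf n hn) (pow_nonneg (hη n) 3))⟩

end IterationGB

section Prop8FromHalvingGB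

variable {F : T4Family} {N : ℕ} [NeZero N]

/-- ★★ **PROPOSITION 8's TOP STEP FROM SECT. F's ONE-STEP IMPROVEMENT, UNDER ANY GUARD, OVER `(bd, Dat)`** («until we reach the bound B₃ε₁»): `HalvingStepTopGB ⇒ Prop8RegSepTopStepGB`
(`0 < B₃`), same constants, guard, datum and data predicate. [cite: Balaban1985Variational, Prop. 8 p.304, Sect. F pp.300–304] -/
theorem prop8RegSepTopStepGB_of_halvingStepTopGB {Sup : (ν : Stage7Numerics) → (K : ℕ) → (ℕ → Set (Site (F.P K) 0)) → Set (Site (F.P K) 0)} {bd : BondDatum F} {Dat : TopData F N}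
    {B₃ a₀ a₁ : ℝ} (hB₃ : 0 < B₃) {Adm : StepGuard F} (h : HalvingStepTopGB F N Sup Adm bd Dat B₃ a₀ a₁) : Prop8RegSepTopStepGB F N Sup Adm bd Dat B₃ a₀ a₁ := by
  intro ν M g K k s hsep hM₁ hadm hk ε₀ δ hδ hcomp hcomp' hε₀ W h7 U h17 h19 hfib hcrit
  have hit := classTop_iterate_of_halvingStepTopGB hB₃.le h ν M g K k s hsep hM₁ hadm hk ε₀ δ hδ hcomp hcomp' hε₀ W h7 U h17 h19 hfib hcrit
  refine ⟨fun n hn => ?_, fun n hn => ?_⟩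
  · obtain ⟨m, hm⟩ := B11.halving_reaches_B3eps1 ε₀ (B₃ * δ n) (mul_pos hB₃ (hδ n hn).1)
    have hP := (hit m).1 n hn
    rwa [hm] at hP
  · obtain ⟨m, hm⟩ := B11.halving_reaches_B3eps1 ε₀ (B₃ * δ n) (mul_pos hB₃ (hδ n hn).1)
    have hD := (hit m).2 n hn
    rwa [hm] at hD

/-- ★ The converse over `(bd, Dat)`: `Prop8RegSepTopStepGB ⇒ HalvingStepTopGB` (one application at the scalar radius `a₀`). [cite: Balaban1985Variational, Prop. 8 p.304 (bookkeeping)] -/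
theorem halvingStepTopGB_of_prop8RegSepTopStepGB {Sup : (ν : Stage7Numerics) → (K : ℕ) → (ℕ → Set (Site (F.P K) 0)) → Set (Site (F.P K) 0)} {bd : BondDatum F} {Dat : TopData F N}
    {B₃ a₀ a₁ : ℝ} {Adm : StepGuard F} (h : Prop8RegSepTopStepGB F N Sup Adm bd Dat B₃ a₀ a₁) : HalvingStepTopGB F N Sup Adm bd Dat B₃ a₀ a₁ := by
  intro ν M g K k s hsep hM₁ hadm hk ε δ hδ hcomp hcomp' hε _hεcomp _hεcomp' W h7 U h17 h19 hfib hcrit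
  have hη : ∀ n, 0 ≤ (F.P K).eta n := eta_nonneg_b (F.P K)
  have h17' : ∀ n, n ≤ k → PlaqSmallOn (Sect2.omegaPlaqsTop s.Ω (Sup ν K s.Ω) n) (a₀ * (F.P K).eta n ^ 2) U := fun n hn =>
    plaqSmallOn_of_le_b (h17 n hn) (mul_le_mul_of_nonneg_right (hε n hn).2 (pow_nonneg (hη n) 2))
  have h19' : Sect2.CoDivClassOnTop s.Ω (Sup ν K s.Ω) k a₀ U := fun n hn =>
    (h19 n hn).of_le (mul_le_mul_of_nonneg_right (hε n hn).2 (pow_nonneg (hη n) 3))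
  obtain ⟨hP, hD⟩ := h ν M g K k s hsep hM₁ hadm hk a₀ δ (fun n hn => ⟨(hδ n hn).1, (hδ n hn).2, (hε n hn).1.trans (hε n hn).2⟩)
    hcomp hcomp' le_rfl W h7 U h17' h19' hfib hcrit
  exact ⟨fun n hn => plaqSmallOn_of_le_b (hP n hn) (mul_le_mul_of_nonneg_right (le_max_left _ _) (pow_nonneg (hη n) 2)),
    fun n hn => (hD n hn).of_le (mul_le_mul_of_nonneg_right (le_max_left _ _) (pow_nonneg (hη n) 3))⟩

/-- ★★ **EQUIVALENCE UNDER ANY GUARD, OVER `(bd, Dat)`** (`0 < B₃`). [cite: Balaban1985Variational, Prop. 8 p.304, Sect. F pp.300–304 (bookkeeping)] -/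
theorem halvingStepTopGB_iff_prop8RegSepTopStepGB {Sup : (ν : Stage7Numerics) → (K : ℕ) → (ℕ → Set (Site (F.P K) 0)) → Set (Site (F.P K) 0)} {bd : BondDatum F} {Dat : TopData F N}
    {Adm : StepGuard F} {B₃ a₀ a₁ : ℝ} (hB₃ : 0 < B₃) : HalvingStepTopGB F N Sup Adm bd Dat B₃ a₀ a₁ ↔ Prop8RegSepTopStepGB F N Sup Adm bd Dat B₃ a₀ a₁ :=
  ⟨prop8RegSepTopStepGB_of_halvingStepTopGB hB₃, halvingStepTopGB_of_prop8RegSepTopStepGB⟩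

/-- ★ THE WHOLE CHAIN IN ONE LINE over `(bd, Dat, Ex0)`: a core-to-top link at the same guard, datum, data predicate and exclusion range, and the core form, give Proposition 8's top step.
[cite: Balaban1985Variational, Prop. 8 p.304, Sect. F pp.300–304 (bookkeeping)] -/
theorem prop8RegSepTopStepGB_of_coreGB_of_link {Sup : (ν : Stage7Numerics) → (K : ℕ) → (ℕ → Set (Site (F.P K) 0)) → Set (Site (F.P K) 0)} {bd : BondDatum F} {Dat : TopData F N}
    {Adm : StepGuard F} {B₃ a₀ a₁ : ℝ} (hB₃ : 0 < B₃)
    {Ex0 : PlaqRange0 F} (hlink : HalvingStepTopCoreGB F N Sup Adm bd Dat Ex0 B₃ a₀ a₁ → HalvingStepTopGB F N Sup Adm bd Dat B₃ a₀ a₁)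
    (hcore : HalvingStepTopCoreGB F N Sup Adm bd Dat Ex0 B₃ a₀ a₁) :
    Prop8RegSepTopStepGB F N Sup Adm bd Dat B₃ a₀ a₁ :=
  prop8RegSepTopStepGB_of_halvingStepTopGB hB₃ (hlink hcore)

end Prop8FromHalvingGB

end Literature.MathematicalPhysics.QuantumFieldTheory.Balaban1983to89.Node00

end
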